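import Mathlib
import Summits.AnomalousDissipation.AnomalousDissipation.Theorems.MarginalStabilityChainStretchedVortexRowsStubRowVorticityConstructionToolsFar
import Summits.AnomalousDissipation.AnomalousDissipation.Theorems.MarginalStabilityChainStretchedVortexRowsStubRowVorticityConstructionToolsSmooth

/-!
# Stub `stub_rowVorticityConstruction` (crux stmt-AnomalousDissipation-3009) — tools XIV:
# exponential decay of strip convolutions of exponentially decaying kernels with Gaussian densities

Helper file (supports stmt-AnomalousDissipation-3009). First brick of the EXPONENTIAL DECAY PACKAGE
`|∂ₓu| + |∂_yu| + |∂ₓv| + |∂_yv| + |∂_y²u| ≤ C′e^{−c|y|}` of the cylinder Biot–Savart velocity (velocity gradients of an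
`x`-periodic field with Gaussian-tailed vorticity decay like `e^{−2π|y|/L}`, not like a Gaussian): the generic
estimate behind it. For a kernel `F` on the strip `S_L` with `|F(q)| ≤ (A + D/‖q‖) e^{−b|q₂|}` (the remainder
`K₁ − tanh` and `K₂` of tools V(a)) and a continuous plane field `g` with `|g(a, t)| ≤ C e^{−a t²}`:

* `exp_abs_mul_gauss_le` — the pointwise inequality `e^{−b|s|} e^{−a(y−s)²} ≤ e^{b²/(16a)} e^{−(b/2)|y|} e^{−(b/2)|s|}`
  (complete the square in `|y − s|`);
* `gauss_le_exp_abs` — `e^{−(a/2)y²} ≤ e^{b²/(8a)} e^{−(b/2)|y|}`;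
* **`exists_strip_conv_le_exp`** — `∃ K, ∀ x y, |∫_{S_L} F(q) g(x − q₁, y − q₂) dq| ≤ K e^{−(b/2)|y|}`.
Registered sub-goal proved here: `stub_rowVorticityConstruction_stripConvDecay`. All `[folklore]`.
-/

set_option linter.dupNamespace false

noncomputable section

open Real Set Filter Topology MeasureTheory

namespace Summit.AnomalousDissipation.AnomalousDissipation.Theorems.MarginalStabilityChainStretchedVortexRows.RowBiotSavart

section DecayConv

/-- **Exponential ⋆ Gaussian, pointwise**: `e^{−b|s|} e^{−a(y−s)²} ≤ e^{b²/(16a)} e^{−(b/2)|y|} e^{−(b/2)|s|}` for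
`a > 0`, `b ≥ 0`. [folklore] -/
theorem exp_abs_mul_gauss_le {a b : ℝ} (ha : 0 < a) (hb : 0 ≤ b) (s y : ℝ) :
    Real.exp (-b * |s|) * Real.exp (-a * (y - s) ^ 2) ≤
      Real.exp (b ^ 2 / (16 * a)) * Real.exp (-(b / 2) * |y|) * Real.exp (-(b / 2) * |s|) := by
  rw [← Real.exp_add, ← Real.exp_add, ← Real.exp_add]
  apply Real.exp_le_exp.2
  have hy : |y| ≤ |s| + |y - s| := by
    have := abs_add_le s (y - s); rwa [add_sub_cancel] at this
  have hr : 0 ≤ |y - s| := abs_nonneg _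
  have hsq : (y - s) ^ 2 = |y - s| ^ 2 := (sq_abs _).symm
  rw [hsq]
  have key : 0 ≤ a * (|y - s| - b / (4 * a)) ^ 2 := by positivity
  have hexp : a * (|y - s| - b / (4 * a)) ^ 2 = a * |y - s| ^ 2 - b / 2 * |y - s| + b ^ 2 / (16 * a) := by
    field_simp; ring
  nlinarith [mul_le_mul_of_nonneg_left hy (by linarith : (0:ℝ) ≤ b / 2)]

/-- `e^{−(a/2)y²} ≤ e^{b²/(8a)} e^{−(b/2)|y|}` (`a > 0`). [folklore] -/
theorem gauss_le_exp_abs {a : ℝ} (ha : 0 < a) (b y : ℝ) :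
    Real.exp (-(a / 2) * y ^ 2) ≤ Real.exp (b ^ 2 / (8 * a)) * Real.exp (-(b / 2) * |y|) := by
  rw [← Real.exp_add]
  apply Real.exp_le_exp.2
  have hsq : y ^ 2 = |y| ^ 2 := (sq_abs _).symm
  rw [hsq]
  have key : 0 ≤ a / 2 * (|y| - b / (2 * a)) ^ 2 := by positivity
  have hexp : a / 2 * (|y| - b / (2 * a)) ^ 2 = a / 2 * |y| ^ 2 - b / 2 * |y| + b ^ 2 / (8 * a) := by
    field_simp; ring
  nlinarith

variable {L : ℝ}

/-- **Exponential decay of strip convolutions.** For `F` measurable with `|F(q)| ≤ (A + D/‖q‖) e^{−b|q₂|}` on `S_L`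
(`A, D ≥ 0`, `b > 0`) and a continuous plane field `g` with `|g(a, t)| ≤ C e^{−a₀ t²}` (`a₀ > 0`), there is `K` with
`|∫_{S_L} F(q) g(x − q₁, y − q₂) dq| ≤ K e^{−(b/2)|y|}` for all `x, y`. [folklore] -/
theorem exists_strip_conv_le_exp {F : ℝ × ℝ → ℝ} (hF : Measurable F) {A D b : ℝ} (hA : 0 ≤ A) (hD : 0 ≤ D)
    (hb : 0 < b) (hle : ∀ q ∈ Ioc (-(L / 2)) (L / 2) ×ˢ (univ : Set ℝ), |F q| ≤ (A + D / ‖q‖) * Real.exp (-b * |q.2|))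
    {g : ℝ → ℝ → ℝ} (hg : Continuous fun p : ℝ × ℝ => g p.1 p.2) {C a₀ : ℝ} (ha₀ : 0 < a₀)
    (hgb : ∀ a t, |g a t| ≤ C * Real.exp (-a₀ * t ^ 2)) :
    ∃ K : ℝ, ∀ x y : ℝ,
      |∫ q in Ioc (-(L / 2)) (L / 2) ×ˢ (univ : Set ℝ), F q * g (x - q.1) (y - q.2)| ≤ K * Real.exp (-(b / 2) * |y|) := by
  set S : Set (ℝ × ℝ) := Ioc (-(L / 2)) (L / 2) ×ˢ (univ : Set ℝ)
  have hSm : MeasurableSet S := measurableSet_Ioc.prod MeasurableSet.univ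
  have hC : 0 ≤ C := by have := (abs_nonneg _).trans (hgb 0 0); simpa using this
  -- the two dominating integrals
  have iE : Integrable (fun q : ℝ × ℝ => Real.exp (-(b / 2) * |q.2|)) (volume.restrict S) := by
    have h0 := MarginalStabilityChainBurgersLayerLowRe.integrable_kernel (half_pos hb) 0
    have h1 : Integrable (fun t : ℝ => Real.exp (-(b / 2) * |t|)) :=
      h0.congr (Eventually.of_forall fun t => by simp only [zero_sub, abs_neg]; ring_nf)
    exact integrable_strip_of_snd L h1
  have iI : Integrable (fun q : ℝ × ℝ => (Metric.ball (0 : ℝ × ℝ) 1).indicator (fun q => ‖q‖⁻¹) q)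
      (volume.restrict S) :=
    ((integrableOn_inv_norm_ball 1).integrable_indicator measurableSet_ball).mono_measure Measure.restrict_le_self
  set IE : ℝ := ∫ q in S, Real.exp (-(b / 2) * |q.2|)
  set II : ℝ := ∫ q in S, (Metric.ball (0 : ℝ × ℝ) 1).indicator (fun q => ‖q‖⁻¹) q
  have hIE : 0 ≤ IE := integral_nonneg fun q => (Real.exp_pos _).le
  have hII : 0 ≤ II := integral_nonneg fun q => indicator_nonneg (fun q _ => inv_nonneg.2 (norm_nonneg q)) q
  set K₁ : ℝ := (A + D) * C * Real.exp (b ^ 2 / (16 * a₀))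
  set K₂ : ℝ := D * C * Real.exp a₀ * Real.exp (b ^ 2 / (8 * a₀))
  refine ⟨K₁ * IE + K₂ * II, fun x y => ?_⟩
  -- pointwise domination on the strip
  have hpt : ∀ q ∈ S, |F q * g (x - q.1) (y - q.2)| ≤
      Real.exp (-(b / 2) * |y|) * (K₁ * Real.exp (-(b / 2) * |q.2|) +
        K₂ * (Metric.ball (0 : ℝ × ℝ) 1).indicator (fun q => ‖q‖⁻¹) q) := by
    intro q hq
    rw [abs_mul]
    have h1 := hle q hq
    have h2 := hgb (x - q.1) (y - q.2)
    have he1 : 0 < Real.exp (-b * |q.2|) := Real.exp_pos _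
    have he2 : 0 < Real.exp (-a₀ * (y - q.2) ^ 2) := Real.exp_pos _
    -- split `D/‖q‖ ≤ D + D‖q‖⁻¹ 1_{ball}`
    have hind : 0 ≤ (Metric.ball (0 : ℝ × ℝ) 1).indicator (fun q : ℝ × ℝ => ‖q‖⁻¹) q :=
      indicator_nonneg (fun q _ => inv_nonneg.2 (norm_nonneg q)) q
    have hD' : D / ‖q‖ * (Real.exp (-b * |q.2|) * Real.exp (-a₀ * (y - q.2) ^ 2)) ≤
        D * (Real.exp (-b * |q.2|) * Real.exp (-a₀ * (y - q.2) ^ 2)) +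
        D * (Metric.ball (0 : ℝ × ℝ) 1).indicator (fun q => ‖q‖⁻¹) q * (Real.exp a₀ * Real.exp (-(a₀ / 2) * y ^ 2)) := by
      by_cases hq1 : q ∈ Metric.ball (0 : ℝ × ℝ) 1
      · rw [indicator_of_mem hq1]
        have hq2 : |q.2| ≤ 1 := by
          rw [Metric.mem_ball, dist_zero_right, Prod.norm_def] at hq1
          exact ((le_max_right _ _).trans hq1.le)
        have hs := exp_shift_le (s := y) (t := q.2) ha₀.le hq2
        have he3 : Real.exp (-b * |q.2|) ≤ 1 := by rw [Real.exp_le_one_iff]; nlinarith [abs_nonneg q.2]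
        have : D / ‖q‖ * (Real.exp (-b * |q.2|) * Real.exp (-a₀ * (y - q.2) ^ 2)) ≤
            D * ‖q‖⁻¹ * (Real.exp a₀ * Real.exp (-(a₀ / 2) * y ^ 2)) := by
          rw [div_eq_mul_inv]
          refine mul_le_mul_of_nonneg_left ?_ (by positivity)
          calc Real.exp (-b * |q.2|) * Real.exp (-a₀ * (y - q.2) ^ 2) ≤ 1 * Real.exp (-a₀ * (y - q.2) ^ 2) :=
                mul_le_mul_of_nonneg_right he3 he2.le
            _ ≤ _ := by rw [one_mul]; exact hs
        nlinarith [mul_nonneg hD (mul_nonneg he1.le he2.le)]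
      · rw [indicator_of_notMem hq1, mul_zero, zero_mul, add_zero]
        rw [Metric.mem_ball, dist_zero_right, not_lt] at hq1
        exact mul_le_mul_of_nonneg_right (div_le_self hD hq1) (by positivity)
    have hL1 := exp_abs_mul_gauss_le ha₀ hb.le q.2 y
    have hL2 := gauss_le_exp_abs ha₀ b y
    calc |F q| * |g (x - q.1) (y - q.2)|
        ≤ (A + D / ‖q‖) * Real.exp (-b * |q.2|) * (C * Real.exp (-a₀ * (y - q.2) ^ 2)) :=
          mul_le_mul h1 h2 (abs_nonneg _) (by positivity)
      _ = C * (A * (Real.exp (-b * |q.2|) * Real.exp (-a₀ * (y - q.2) ^ 2)) +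
            D / ‖q‖ * (Real.exp (-b * |q.2|) * Real.exp (-a₀ * (y - q.2) ^ 2))) := by ring
      _ ≤ C * (A * (Real.exp (-b * |q.2|) * Real.exp (-a₀ * (y - q.2) ^ 2)) +
            (D * (Real.exp (-b * |q.2|) * Real.exp (-a₀ * (y - q.2) ^ 2)) +
              D * (Metric.ball (0 : ℝ × ℝ) 1).indicator (fun q => ‖q‖⁻¹) q *
                (Real.exp a₀ * Real.exp (-(a₀ / 2) * y ^ 2)))) := by
          refine mul_le_mul_of_nonneg_left (by linarith) hC
      _ = C * (A + D) * (Real.exp (-b * |q.2|) * Real.exp (-a₀ * (y - q.2) ^ 2)) +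
            C * D * Real.exp a₀ * (Metric.ball (0 : ℝ × ℝ) 1).indicator (fun q => ‖q‖⁻¹) q *
              Real.exp (-(a₀ / 2) * y ^ 2) := by ring
      _ ≤ C * (A + D) * (Real.exp (b ^ 2 / (16 * a₀)) * Real.exp (-(b / 2) * |y|) * Real.exp (-(b / 2) * |q.2|)) +
            C * D * Real.exp a₀ * (Metric.ball (0 : ℝ × ℝ) 1).indicator (fun q => ‖q‖⁻¹) q *
              (Real.exp (b ^ 2 / (8 * a₀)) * Real.exp (-(b / 2) * |y|)) := by
          refine add_le_add (mul_le_mul_of_nonneg_left hL1 (by positivity))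
            (mul_le_mul_of_nonneg_left hL2 (by positivity))
      _ = _ := by simp only [K₁, K₂]; ring
  have iFg : Integrable (fun q : ℝ × ℝ => |F q * g (x - q.1) (y - q.2)|) (volume.restrict S) := by
    have hm : AEStronglyMeasurable (fun q : ℝ × ℝ => F q * g (x - q.1) (y - q.2)) (volume.restrict S) :=
      hF.aestronglyMeasurable.mul (hg.comp ((continuous_const.sub continuous_fst).prodMk
        (continuous_const.sub continuous_snd))).aestronglyMeasurable
    refine (Integrable.mono' (((iE.const_mul K₁).add (iI.const_mul K₂)).const_mul (Real.exp (-(b / 2) * |y|))) hm ?_).abs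
    rw [ae_restrict_iff' hSm]
    refine Eventually.of_forall fun q hq => ?_
    rw [Real.norm_eq_abs]; exact hpt q hq
  calc |∫ q in S, F q * g (x - q.1) (y - q.2)| ≤ ∫ q in S, |F q * g (x - q.1) (y - q.2)| := abs_integral_le_integral_abs
    _ ≤ ∫ q in S, Real.exp (-(b / 2) * |y|) * (K₁ * Real.exp (-(b / 2) * |q.2|) +
          K₂ * (Metric.ball (0 : ℝ × ℝ) 1).indicator (fun q => ‖q‖⁻¹) q) :=
        setIntegral_mono_on iFg (((iE.const_mul K₁).add (iI.const_mul K₂)).const_mul _) hSm hpt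
    _ = (K₁ * IE + K₂ * II) * Real.exp (-(b / 2) * |y|) := by
        rw [integral_const_mul, integral_add (iE.const_mul K₁) (iI.const_mul K₂), integral_const_mul, integral_const_mul]
        ring

end DecayConv

end RowBiotSavart

open RowBiotSavart in
/-- **Exponential decay of strip convolutions** (registered on stmt-AnomalousDissipation-3009 as the helper stub
`stub_rowVorticityConstruction_stripConvDecay` of `stub_rowVorticityConstruction`): for a measurable kernel `F` on
`S_L` with `|F(q)| ≤ (A + D/‖q‖) e^{−b|q₂|}` (`A, D ≥ 0`, `b > 0`) and a continuous plane field `g` with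
`|g(a, t)| ≤ C e^{−a₀t²}` (`a₀ > 0`), there is `K` with `|∫_{S_L} F(q) g(x − q₁, y − q₂) dq| ≤ K e^{−(b/2)|y|}` for
all `x, y` (`RowBiotSavart.exists_strip_conv_le_exp`). [folklore] -/
theorem stub_rowVorticityConstruction_stripConvDecay :
    ∀ (L : ℝ) (F : ℝ × ℝ → ℝ) (A D b : ℝ) (g : ℝ → ℝ → ℝ) (C a₀ : ℝ), Measurable F → 0 ≤ A → 0 ≤ D → 0 < b →
      (∀ q ∈ Set.Ioc (-(L / 2)) (L / 2) ×ˢ (Set.univ : Set ℝ), |F q| ≤ (A + D / ‖q‖) * Real.exp (-b * |q.2|)) →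
      Continuous (fun p : ℝ × ℝ => g p.1 p.2) → 0 < a₀ → (∀ a t, |g a t| ≤ C * Real.exp (-a₀ * t ^ 2)) →
      ∃ K : ℝ, ∀ x y : ℝ,
        |∫ q in Set.Ioc (-(L / 2)) (L / 2) ×ˢ (Set.univ : Set ℝ), F q * g (x - q.1) (y - q.2)| ≤
          K * Real.exp (-(b / 2) * |y|) :=
  fun _ _ _ _ _ _ _ _ hF hA hD hb hle hg ha₀ hgb => exists_strip_conv_le_exp hF hA hD hb hle hg ha₀ hgb

end Summit.AnomalousDissipation.AnomalousDissipation.Theorems.MarginalStabilityChainStretchedVortexRows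

end
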